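import Summits.NavierStokesRegularity.FunctionalMining.TopEigHeatMollifiedCeiling
import HarnessLib

/-!
# FunctionalMining — the RATE CEILING ON THE `x₂`-LAMINATE CLASS: `HeatCoerciveOn IsX2Laminate Φ_q c → c ≤ 16π²(q−1)/q`
# for every real `q ≥ 1` (both one-sided cores)

HONEST FRAMING. Search for candidate a priori estimates; no regularity claim. Nothing about Navier–Stokes is
proved or asserted in this file. Cell `pub-nsfunc`, prove seat (gen 31), own lane; a one-screen corollary of
`TopEigHeatMollifiedCeiling.lean`: the mollified optimal laminates `lamU (mollF q ε hε)` ARE `x₂`-laminates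
(`TopEigLaminateTwo.IsX2Laminate`), so the per-`ε` line-drop bound and the limit `R_ε(q) → 16π²(q−1)/q` cap every
admissible rate of the dictionary's CLASS-RESTRICTED coercivity `HeatCoerciveOn IsX2Laminate Φ_q c`
(`TopEigHeatCoerciveGap.HeatCoerciveOn`), not only the unrestricted constant `C_λ(q)`.

CONTENT. **`heatCoerciveOn_laminate_rate_le : HeatCoerciveOn IsX2Laminate (∫(λ₁⁺)^q) c → c ≤ 16π²(q−1)/q`**
(`q ≥ 1`), the `−λ₃` core `heatCoerciveOn_laminate_negBot_rate_le`, and the calibration remark `isX2Laminate_lamU_mollF`.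
MEANING (records only). The tree's K37b-style FLOORS on the laminate class (`heatCoerciveOn_laminate_two` at `q = 2`,
rate `8π²`; the no-go seat's `4π²(q−1)/q` and — staged, K40b/K40d — `16π²(q−1)/q` for every real `q > 1`) and this
CEILING bracket the best laminate-class rate; once the `16π²(q−1)/q` floor is in the tree the bracket closes EXACTLY
(the set of admissible laminate-class rates is `(−∞, 16π²(q−1)/q]`). At `q = 2` the bracket is already closed by the
tree: `8π²` is both floor (`laminate_rigid_two`) and ceiling (this file). UPPER bound only here; Lemma L-λ(q) OPEN in
the kernel for every real `q > 1`; no node decided. [ours]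
FILING (prove seat g33, SLOT OWN-M3, READY INBOX l.5611, queued (59g) l.5806 / (59m) l.5827): = staged `pub-nsfunc-prove/staged/g31-own/TopEigHeatLaminateClassCeiling.lean` 6f19d8d497271b05; this line is the only addition.
-/

noncomputable section

open MeasureTheory Set intervalIntegral Real Filter
open scoped ContDiff Topology

namespace Summit.NavierStokesRegularity.FunctionalMining

open Literature.Analysis Literature.Analysis.FunctionSpaces Literature.Analysis.FunctionSpaces.Torus
open TopEig PlanarTopEig StrainL4 LaminateDirection LaminateWindow

namespace TopEigLaminate

variable {q ε c : ℝ}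

/-- The mollified witnesses are `x₂`-laminates. [ours, bookkeeping] -/
theorem isX2Laminate_lamU_mollF (hε : 0 < ε) : IsX2Laminate (lamU (mollF q ε hε)) := ⟨_, rfl⟩

/-- **Per-`ε` class bound**: a laminate-class rate `c` obeys `c ≤ R_ε(q)` (`q ≥ 1`, `ε > 0`). [ours] -/
theorem le_mollRate_of_heatCoerciveOn_laminate (hq : 1 ≤ q) (hε : 0 < ε)
    (h : HeatCoerciveOn (d := Fin 3) IsX2Laminate (torusTopEigMoment q) c) : c ≤ mollRate q ε := by
  have hΦ := (moment_lamU_mollF_pos hε (by linarith : (0 : ℝ) < q)).1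
  have hc := h (by simp) (lamU (mollF q ε hε)) (isSmooth_lamU _) (isDivFree_lamU _)
    (hasZeroMean_lamU_mollF (q := q) hε) (isX2Laminate_lamU_mollF (q := q) hε)
  have hup : heatDissipation (torusTopEigMoment q) (lamU (mollF q ε hε)) ≤
      mollRate q ε * torusTopEigMoment q (lamU (mollF q ε hε)) :=
    heatDissipation_le_of_line fun t _ => (mollMoment_drop_le hε hq t).1
  exact le_of_mul_le_mul_right (hc.trans hup) hΦ

/-- **THEOREM (rate ceiling on the laminate class). `HeatCoerciveOn IsX2Laminate (∫(λ₁⁺)^q) c → c ≤ 16π²(q−1)/q`**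
for every real `q ≥ 1`. [ours] -/
theorem heatCoerciveOn_laminate_rate_le (hq : 1 ≤ q)
    (h : HeatCoerciveOn (d := Fin 3) IsX2Laminate (torusTopEigMoment q) c) : c ≤ 16 * π ^ 2 * (q - 1) / q :=
  ge_of_tendsto (tendsto_mollRate hq) (eventually_mem_nhdsWithin.mono fun _ hε =>
    le_mollRate_of_heatCoerciveOn_laminate hq hε h)

/-- Per-`ε` class bound for the `−λ₃` core. [ours] -/
theorem le_mollRate_of_heatCoerciveOn_laminate_negBot (hq : 1 ≤ q) (hε : 0 < ε)
    (h : HeatCoerciveOn (d := Fin 3) IsX2Laminate (torusNegBotEigMoment q) c) : c ≤ mollRate q ε := by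
  have hΨ := (moment_lamU_mollF_pos hε (by linarith : (0 : ℝ) < q)).2
  have hc := h (by simp) (lamU (mollF q ε hε)) (isSmooth_lamU _) (isDivFree_lamU _)
    (hasZeroMean_lamU_mollF (q := q) hε) (isX2Laminate_lamU_mollF (q := q) hε)
  have hup : heatDissipation (torusNegBotEigMoment q) (lamU (mollF q ε hε)) ≤
      mollRate q ε * torusNegBotEigMoment q (lamU (mollF q ε hε)) :=
    heatDissipation_le_of_line fun t _ => (mollMoment_drop_le hε hq t).2
  exact le_of_mul_le_mul_right (hc.trans hup) hΨ

/-- **The same ceiling for the `−λ₃` core `∫((−λ₃)⁺)^q` on the laminate class** (`q ≥ 1`). [ours] -/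
theorem heatCoerciveOn_laminate_negBot_rate_le (hq : 1 ≤ q)
    (h : HeatCoerciveOn (d := Fin 3) IsX2Laminate (torusNegBotEigMoment q) c) : c ≤ 16 * π ^ 2 * (q - 1) / q :=
  ge_of_tendsto (tendsto_mollRate hq) (eventually_mem_nhdsWithin.mono fun _ hε =>
    le_mollRate_of_heatCoerciveOn_laminate_negBot hq hε h)

/-- **At `q = 2` the laminate-class bracket is closed by the tree: `8π²` is an admissible class rate
(`heatCoerciveOn_laminate_two`) and no class rate exceeds `8π² = 16π²(2−1)/2`.** [ours, calibration] -/
theorem heatCoerciveOn_laminate_two_iff_le :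
    (∀ c : ℝ, HeatCoerciveOn (d := Fin 3) IsX2Laminate (torusTopEigMoment 2) c ↔ c ≤ 8 * π ^ 2) := by
  intro c
  constructor
  · intro h
    have := heatCoerciveOn_laminate_rate_le (c := c) (by norm_num : (1 : ℝ) ≤ 2) h
    linarith [this, show 16 * π ^ 2 * ((2 : ℝ) - 1) / 2 = 8 * π ^ 2 by ring]
  · intro hc hd v hv hdiv hmean hP
    have h8 := heatCoerciveOn_laminate_two hd v hv hdiv hmean hP
    have hΦ : 0 ≤ torusTopEigMoment 2 v := torusTopEigMoment_nonneg 2 v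
    nlinarith

end TopEigLaminate

end Summit.NavierStokesRegularity.FunctionalMining

end
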